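import Summits.FinalStateConjecture.FinalStateConjecture.Theorems.HonestFixedRadiusSettlingT.Negative.FlatClassCensusT
import Summits.FinalStateConjecture.FinalStateConjecture.Theorems.StarvedNecksHonestFixedRadiusSettlingStubHonestPushforward
import Summits.FinalStateConjecture.FinalStateConjecture.Theorems.PhaseMixingCaptureWeakCosmicCensorshipMGHDStubScriTransfer
import Summits.FinalStateConjecture.FinalStateConjecture.Theorems.ZeroEnergyKerrOrBombStationaryLimitReductionOneDevelopment
import Literature.Geometry.Lorentzian.IsometricImmersionExp
import Summits.FinalStateConjecture.FinalStateConjecture.Theorems.PhaseMixingCaptureWeakCosmicCensorshipMGHDCompleteNullInfinityInvariant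
import Literature.Geometry.Lorentzian.MGHDUniqueness
import HarnessLib

/-!
# Crux `StarvedNecks.HonestFixedRadiusSettlingT` (stmt-FinalStateConjecture-17575), line `Sketch` —
# the SINGLE-DEVELOPMENT COLLAPSE of `T`

`T = Theses.StarvedNecks.HonestFixedRadiusSettlingT` is, for every data manifold `Σ`, TAME Christodoulou
genericity (codimension `1`) in `admissibleVacuumData Σ` of
`P_T D := (∃ 𝒟 MGHD) ∧ ∀ 𝒟 MGHD, 𝒟 ∈ settledT D` (`Negative.FlatClass.T_iff`, `Iff.rfl`), where
`settledT D` (complete `𝓘⁺`; an honest fixed-radius `C⁴` decomposition of the self-determined exterior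
`O = J⁺(ιΣ) ∩ I⁻(charted)` with the rays clause, `HonestCore`, `HonestFar` and pairwise distinct hole
velocities) is the universal conjunct. Every dynamical theorem in print (stability of Minkowski, Kerr
stability) produces ONE development; the `∀ MGHD` of `P_T` is then owed by TRANSPORT along the isometries of
developments supplied by MGHD uniqueness (Choquet-Bruhat–Geroch 1969, Thm. 3; tree theorem
`VacuumCauchyDevelopment.isIsometricTo_of_isMaximal'`, unconditional). This file pays that debt for `T`'s
clause set (line lead c5, cycle 6; the T2-summit analogue is
`ClusterCompleteness.finalStateConjecture_iff_tame_generic_exists_settlesT2`):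

* `exists_honestPushforward_velocity` — the honest pushforward of a decomposition along an isometric open
  embedding (`StarvedNecks.SheetBurial.stub_honestPushforward`) KEEPS the labels, hence the distinct-velocity
  clause (EDIT 3 of `T`) rides along;
* `rayless_of_isIsometricTo`, `settledT_of_isIsometricTo` — **the universal conjunct of `P_T` (with or
  without the rays clause) is a property of the isometry class of a development**: complete `𝓘⁺`
  (`hasCompleteNullInfinity_iff_of_isIsometricTo`), the exterior (`image_exteriorOf`), the rays clause
  (rays lift along isometries on the same affine domain) and the honest clauses are transported;
* `PT_iff_exists_isMaximal_settledT`, `PTnr_iff_exists_isMaximal` — per datum, "an MGHD exists and every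
  MGHD is settled" iff "SOME maximal development is settled";
* `T_iff_tame_generic_exists_settledT` — **THE SINGLE-DEVELOPMENT FORM OF THE CRUX**:
  `T ↔ ∀ Σ, IsTameChristodoulouGeneric (admissibleVacuumData Σ) (fun D ↦ ∃ 𝒟, 𝒟.IsMaximal ∧ 𝒟 ∈ settledT D) 1`
  — one development per datum, no `∀ MGHD`; the `∃`-form a stability theorem outputs; likewise for the
  rays-less core (`rayless_iff_tame_generic_exists`, the member property of line `Sketch`'s dynamical stub).

The trivial fibre (Minkowski space is `T`-settled; every MGHD of `(ℝ³, δ, 0)` is; `P_T (ℝ³, δ, 0)` iff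
Minkowski space is maximal) is the sequel `…TTrivialFibre`. Everything is proved; Mathlib + landed tree
modules only; no definitions.

References: Choquet-Bruhat–Geroch, Comm. Math. Phys. 14 (1969), Thm. 3 (MGHD unique up to isometry);
Ringström 2009, Thm. 16.6; Christodoulou, CQG 16 (1999) A23, pp. A24, A26–A27; Dafermos–Luk,
arXiv:1710.01722, Conjecture 1; O'Neill 1983, Ch. 3 pp. 90–91, Ch. 14 pp. 402–403.
-/

-- every `Summit.FinalStateConjecture.FinalStateConjecture.…` name repeats the summit = sub-problem segment (D-0017 layout)
set_option linter.dupNamespace false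

noncomputable section

open scoped Manifold ContDiff Topology
open Set Filter TopologicalSpace Function

namespace Summit.FinalStateConjecture.FinalStateConjecture.Theorems.StarvedNecks.SingleDevelopment

open Literature.Geometry.Lorentzian
open Summit.FinalStateConjecture (HasCompleteNullInfinity exteriorOf RaysStayInClosure)
open Summit.FinalStateConjecture.FinalStateConjecture.Theses.StarvedNecks (HonestFixedRadiusSettlingT)
open Summit.FinalStateConjecture.FinalStateConjecture.Theorems.HonestFixedRadiusSettling.Negative
  (honestCoreSet honestFarSet mem_honestCoreSet_iff_of_N_eq_zero mem_honestFarSet_iff_of_N_eq_zero)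
open Summit.FinalStateConjecture.FinalStateConjecture.Theorems.HonestFixedRadiusSettlingT.Negative.FlatClass
  (velocitySet settledT)
open Summit.FinalStateConjecture.FinalStateConjecture.Theorems.SwallowTheDatum.UniversalWitnessFamily
  (isLateChart_comp deviationExtend_comp deviationCk_comp truncDeviationCk_comp
    image_diff_subset_causalPast_image pairwise_disjoint_image_comp)
open Summit.FinalStateConjecture.FinalStateConjecture.Theorems.StarvedNecks.SheetBurial
  (image_comp_subset_causalPast_image_comp closure_image_comp_inter_image_subset
    closure_image_comp_subset_of_subset_range isFutureDirected_mfderiv_comp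
    supCkENorm_deviationExtend_comp_le)
open Summit.FinalStateConjecture.FinalStateConjecture.Theorems.OneLockedExplosion (image_exteriorOf isIsometry_symm)
open Summit.FinalStateConjecture.FinalStateConjecture.Theorems.PhaseMixingCapture.WeakCosmicCensorshipMGHD
  (hasCompleteNullInfinity_iff_of_isIsometricTo exists_isNormalisedNullRayFrom_lift)

/-! ### §1 Honest decompositions with their labels push forward along isometric open embeddings -/

section Pushforward

/-- **Honest pushforward, keeping the labels.** Verbatim `StarvedNecks.SheetBurial.stub_honestPushforward`
(`χ : 𝓢 → 𝓢'` smooth, open embedding, isometric immersion, time-orientation preserving; `d` a `Cᵏ`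
decomposition of `O` in `honestCoreSet ∩ honestFarSet` at `R₀`; no escape of the far flat slabs), with the
ONE extra output `T` needs: `χ_* d` has the same holes and motions, so pairwise distinct hole velocities
(`velocitySet`, EDIT 3 of `T`) are transported (the landed stub hides `χ_* d` behind an `∃`; the proof is
the landed one, field by field). [cite: ONeill1983, Ch. 3, pp. 90–91 and Ch. 14, pp. 402–403] -/
theorem exists_honestPushforward_velocity
    (𝓢 𝓢' : Spacetime.{0} 4) (χ : 𝓢.carrier → 𝓢'.carrier)
    (hχ : ContMDiff (𝓡 4) (𝓡 4) ∞ χ) (hχo : Topology.IsOpenEmbedding χ)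
    (hisoχ : 𝓢.metric.IsIsometricImmersion 𝓢'.metric.toPseudoRiemannianMetric χ)
    (hτ : 𝓢.timeOrientation.PreservesTimeOrientation χ 𝓢'.timeOrientation)
    (O : Set 𝓢.carrier) (k : ℕ) (d : FinalStateDecomposition 𝓢 O k) (R₀ : ℝ)
    (hc : d ∈ honestCoreSet 𝓢 O k R₀) (hf : d ∈ honestFarSet 𝓢 O k R₀)
    (hesc : ∀ τ' : ℝ, d.τ₀ < τ' →
      closure (χ '' (d.flatChart '' {y | τ' ≤ y.1 0 ∧
        ∀ i, d.excision i (y.1 0) + 1 ≤ (d.background i).radius y.1})) ⊆ Set.range χ)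
    (hv : d ∈ velocitySet 𝓢 O k) :
    ∃ d' : FinalStateDecomposition 𝓢' (χ '' O) k,
      d'.charted = χ '' d.charted ∧
      d' ∈ honestCoreSet 𝓢' (χ '' O) k R₀ ∧ d' ∈ honestFarSet 𝓢' (χ '' O) k R₀ ∧
      d' ∈ velocitySet 𝓢' (χ '' O) k := by
  obtain ⟨hc1, hc2, hc3, hc4⟩ := hc
  obtain ⟨hf1, hf2, hf3⟩ := hf
  have hinj : Injective χ := hχo.injective
  have hχd : MDifferentiable (𝓡 4) (𝓡 4) χ := hχ.mdifferentiable (by simp)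
  have hφ : ∀ y, pullbackBilin (I := 𝓡 4) (I' := 𝓡 4) χ 𝓢'.metric.val y = 𝓢.metric.val y :=
    hisoχ.2
  have hΨd : ∀ i, MDifferentiable 𝓘(ℝ, E4) (𝓡 4) (d.chart i) := fun i ↦
    (d.isLateChart i).contMDiff.mdifferentiable (by simp)
  have hΦd : MDifferentiable 𝓘(ℝ, E4) (𝓡 4) d.flatChart :=
    d.isLateChart_flat.contMDiff.mdifferentiable (by simp)
  -- the pushed-forward decomposition `χ_* d` (verbatim the landed construction)
  let d' : FinalStateDecomposition 𝓢' (χ '' O) k :=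
    { N := d.N
      mass := d.mass
      spin := d.spin
      mass_pos := d.mass_pos
      abs_spin_le_mass := d.abs_spin_le_mass
      motion := d.motion
      τ₀ := d.τ₀
      chart := fun i ↦ χ ∘ d.chart i
      isLateChart := fun i ↦ isLateChart_comp _ (d.isLateChart i) hχ hχo
      tendsto_truncDeviationCk := fun i R' ↦ (d.tendsto_truncDeviationCk i R').congr fun τ ↦
        (truncDeviationCk_comp (d.background i) hχd hφ (hΨd i) k R' τ).symm
      exists_pairwise_disjoint := fun R' ↦ by
        obtain ⟨τ₁, hτ₁⟩ := d.exists_pairwise_disjoint R'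
        exact ⟨τ₁, pairwise_disjoint_image_comp hinj _ _ hτ₁⟩
      excision := d.excision
      tendsto_excision_div := d.tendsto_excision_div
      flatDomain := d.flatDomain
      setOf_lt_excision_subset_flatDomain := d.setOf_lt_excision_subset_flatDomain
      flatChart := χ ∘ d.flatChart
      isLateChart_flat := isLateChart_comp _ d.isLateChart_flat hχ hχo
      tendsto_deviationCk_flat := d.tendsto_deviationCk_flat.congr fun τ ↦
        (deviationCk_comp (Minkowski.backgroundOn d.flatDomain) hχd hφ hΦd k τ).symm
      diff_subset_causalPast := by
        have h := image_diff_subset_causalPast_image hχd hτ hφ hinj d.diff_subset_causalPast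
        simpa only [image_union, image_iUnion, image_comp] using h }
  refine ⟨d', ?_, ⟨hc1, fun i ϱ τ₂ hϱ hτ₂ ↦ ?_, fun i τ' ϱ hϱ hτ' ↦ ?_, fun y hy ↦ ?_⟩,
    ⟨fun τ₂ hτ₂ ↦ ?_, fun τ' hτ' ↦ ?_, fun i ↦ ?_⟩, fun i j hij ↦ hv i j hij⟩
  · -- the charted region
    simp only [d', FinalStateDecomposition.charted, FinalStateDecomposition.radiationZone,
      FinalStateDecomposition.region, FinalStateDecomposition.background, image_union,
      image_iUnion, image_comp]
  · -- C2: anchoring at every radius `≥ R₀`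
    exact image_comp_subset_causalPast_image_comp hχd hτ hφ (hc2 i ϱ τ₂ hϱ hτ₂)
  · -- C3: relative closedness in `χ O` of the late tube portions
    exact closure_image_comp_inter_image_subset hχo (hc3 i τ' ϱ hϱ hτ')
  · -- C4: the flat chart of `χ_* d` is future oriented
    exact isFutureDirected_mfderiv_comp hχd hτ hφ hΦd (hc4 y hy)
  · -- F1: flat-late points below later flat slabs
    exact image_comp_subset_causalPast_image_comp hχd hτ hφ (hf1 τ₂ hτ₂)
  · -- F2: closures of far flat slabs are flat points (no escape)
    exact closure_image_comp_subset_of_subset_range hχo (hf2 τ' hτ') (hesc τ' hτ')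
  · -- F3: the same late time `T`, the deviation functions being identical
    obtain ⟨T, hT⟩ := hf3 i
    exact ⟨T, supCkENorm_deviationExtend_comp_le (d.background i) hχd hφ (hΨd i) hT⟩

end Pushforward

/-! ### §1b Rays stay in the closure (private copy of `ClusterCompleteness.raysStayInClosure_image_of_isometry`,
kept local so that the import cone stays inside modules the gate has built) -/

section Rays

variable {X : Type} [TopologicalSpace X] [ChartedSpace E3 X] [IsManifold (𝓡 3) ∞ X]
  [ConnectedSpace X] {D : InitialDataSet (𝓡 3) X}

/-- `RaysStayInClosure 𝒟₁ O → RaysStayInClosure 𝒟₂ (ψ '' O)` for a time-orientation preserving isometric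
diffeomorphism `ψ : 𝒟₁ ≃ 𝒟₂` with `ψ ∘ ι₁ = ι₂`: a ray of `𝒟₂` from `ι₂ p` lifts along `ψ` to one of `𝒟₁`
from `p` on the SAME domain (`exists_isNormalisedNullRayFrom_lift`; `ψ⁻¹ ∘ γ` is a `g₁`-geodesic extending
the maximal lift), and `ψ (closure O) ⊆ closure (ψ O)`. O'Neill 1983, Ch. 3, pp. 90–91. [folklore] -/
private theorem raysStayInClosure_image_of_isometry' {𝒟₁ 𝒟₂ : CauchyDevelopment D}
    (ψ : Diffeomorph (𝓡 4) (𝓡 4) 𝒟₁.carrier 𝒟₂.carrier ∞)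
    (hiso : ∀ y, pullbackBilin (I := 𝓡 4) (I' := 𝓡 4) ψ 𝒟₂.metric.val y = 𝒟₁.metric.val y)
    (hτ : 𝒟₁.timeOrientation.PreservesTimeOrientation ψ 𝒟₂.timeOrientation)
    (hι : ψ ∘ 𝒟₁.embed = 𝒟₂.embed) (O : Set 𝒟₁.carrier)
    (h : RaysStayInClosure 𝒟₁ O) : RaysStayInClosure 𝒟₂ (ψ '' O) := by
  intro inst₂ p γ dom hγ hdom t ht ht0
  haveI inst₁ : 𝒟₁.metric.HasLeviCivita := PseudoRiemannianMetric.hasLeviCivita _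
  have hΦ : ContMDiff (𝓡 3) (𝓡 3) (∞ + 1) (id : X → X) := contMDiff_id
  have hΦ' : ∀ u : X, Function.Injective (mfderiv (𝓡 3) (𝓡 3) (id : X → X) u) := fun u ↦ by
    rw [mfderiv_id]
    exact fun v w hvw ↦ hvw
  have key : ∀ (D' : InitialDataSet (𝓡 3) X), D.comap id hΦ hΦ' = D' →
      ∀ (𝒮 : DataEmbedding D') (χ : 𝒮.carrier → 𝒟₂.carrier),
        ContMDiff (𝓡 4) (𝓡 4) ∞ χ →
        𝒮.metric.IsIsometricImmersion 𝒟₂.metric.toPseudoRiemannianMetric χ →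
        𝒮.timeOrientation.PreservesTimeOrientation χ 𝒟₂.timeOrientation →
        χ ∘ 𝒮.embed = 𝒟₂.embed ∘ id →
        ∀ [𝒮.metric.HasLeviCivita],
          ∃ (γ' : ℝ → 𝒮.carrier) (dom' : Set ℝ),
            𝒮.metric.IsNormalisedNullRayFrom 𝒮.timeOrientation 𝒮.embed 𝒮.normal p γ' dom' ∧
              dom' ⊆ dom ∧ ∀ s ∈ dom', χ (γ' s) = γ s := by
    intro D' e
    subst e
    intro 𝒮 χ hχ hisoχ hτχ hcomm _
    exact exists_isNormalisedNullRayFrom_lift 𝒟₂.toDataEmbedding 𝒮 hχ hisoχ hτχ hcomm hγ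
  obtain ⟨γ₁, dom₁, hγ₁, hsub, hagree⟩ := key D (D.comap_eq_self_of_eq_id hΦ hΦ' rfl)
    𝒟₁.toDataEmbedding ψ ψ.contMDiff ⟨ψ.contMDiff, hiso⟩ hτ (by rw [hι]; rfl)
  have hsymm : 𝒟₂.metric.toPseudoRiemannianMetric.IsIsometricImmersion
      𝒟₁.metric.toPseudoRiemannianMetric ψ.symm :=
    ⟨ψ.symm.contMDiff, isIsometry_symm (𝓢₁ := 𝒟₁.toSpacetime) (𝓢₂ := 𝒟₂.toSpacetime) ψ hiso⟩
  have hmax := hγ.isMaximalGeodesicOn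
  have hmax₁ := hγ₁.isMaximalGeodesicOn
  have hgeo : IsGeodesicOn 𝒟₁.metric.toPseudoRiemannianMetric.leviCivita (ψ.symm ∘ γ) dom :=
    (hsymm.isGeodesicOn_comp rfl hmax.1 hmax.isGeodesicOn).1
  have hdom : dom = dom₁ :=
    hmax₁.2.2.2 (ψ.symm ∘ γ) dom hmax.1 hmax.2.1 hsub hgeo fun s hs ↦ by
      simp only [Function.comp_apply, ← hagree s hs, Diffeomorph.symm_apply_apply]
  subst hdom
  have hmem : γ₁ t ∈ closure O := h p γ₁ dom hγ₁ hdom t ht ht0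
  rw [← hagree t ht]
  exact image_closure_subset_closure_image ψ.continuous (Set.mem_image_of_mem _ hmem)

end Rays

/-! ### §2 The universal conjunct of `P_T` is a property of the isometry class of a development -/

section PerDevelopment

variable {X : Type} [TopologicalSpace X] [ChartedSpace E3 X] [IsManifold (𝓡 3) ∞ X] [ConnectedSpace X]
  {D : InitialDataSet (𝓡 3) X}

/-- **The RAYS-LESS universal conjunct of `P_T` is transported along isometries of developments.** The
rays-less conjunct (complete `𝓘⁺` and an honest fixed-radius `C⁴` decomposition of the self-determined
exterior with `HonestCore`, `HonestFar` and distinct velocities — exactly what the dynamical stub of line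
`Sketch` re-witnesses along clean curves, `CoreReduction.T_iff_rayless`; written out, no new definition) passes
from `𝒟₁` to any `𝒟₂ ≅ 𝒟₁` (a time-orientation preserving isometric diffeomorphism `ψ` with `ψ ∘ ι₁ = ι₂`):
complete `𝓘⁺` is an invariant (`hasCompleteNullInfinity_iff_of_isIsometricTo`); the decomposition `d` of
`O = exteriorOf 𝒟₁ d.charted` pushes forward, labels kept, to an honest one of `ψ(O)` with charted region
`ψ(d.charted)` (`exists_honestPushforward_velocity`; no escape is possible along a surjection), and
`ψ(O) = exteriorOf 𝒟₂ ψ(d.charted)` (`image_exteriorOf`). [cite: ChoquetBruhatGeroch1969CMP, Thm. 3] -/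
theorem rayless_of_isIsometricTo {𝒟₁ 𝒟₂ : VacuumCauchyDevelopment D}
    (h : 𝒟₁.toCauchyDevelopment.IsIsometricTo 𝒟₂.toCauchyDevelopment)
    (hS : HasCompleteNullInfinity 𝒟₁.toCauchyDevelopment ∧
      ∃ (O : Set 𝒟₁.carrier) (d : FinalStateDecomposition 𝒟₁.toSpacetime O 4) (R₀ : ℝ),
        O = exteriorOf 𝒟₁.toCauchyDevelopment d.charted ∧
          d ∈ honestCoreSet 𝒟₁.toSpacetime O 4 R₀ ∧ d ∈ honestFarSet 𝒟₁.toSpacetime O 4 R₀ ∧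
            d ∈ velocitySet 𝒟₁.toSpacetime O 4) :
    HasCompleteNullInfinity 𝒟₂.toCauchyDevelopment ∧
      ∃ (O : Set 𝒟₂.carrier) (d : FinalStateDecomposition 𝒟₂.toSpacetime O 4) (R₀ : ℝ),
        O = exteriorOf 𝒟₂.toCauchyDevelopment d.charted ∧
          d ∈ honestCoreSet 𝒟₂.toSpacetime O 4 R₀ ∧ d ∈ honestFarSet 𝒟₂.toSpacetime O 4 R₀ ∧
            d ∈ velocitySet 𝒟₂.toSpacetime O 4 := by
  obtain ⟨hI, O, d, R₀, hO, hc, hf, hv⟩ := hS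
  refine ⟨(hasCompleteNullInfinity_iff_of_isIsometricTo _ _ h).1 hI, ?_⟩
  obtain ⟨ψ, hiso, hτ, hι⟩ := h
  have hesc : ∀ τ' : ℝ, d.τ₀ < τ' →
      closure ((ψ : 𝒟₁.carrier → 𝒟₂.carrier) '' (d.flatChart '' {y | τ' ≤ y.1 0 ∧
        ∀ i, d.excision i (y.1 0) + 1 ≤ (d.background i).radius y.1})) ⊆
          Set.range (ψ : 𝒟₁.carrier → 𝒟₂.carrier) := fun τ' _ z _ ↦
    ⟨ψ.symm z, ψ.apply_symm_apply z⟩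
  obtain ⟨d', hch, hc', hf', hv'⟩ :=
    exists_honestPushforward_velocity 𝒟₁.toSpacetime 𝒟₂.toSpacetime ψ ψ.contMDiff
      ψ.toHomeomorph.isOpenEmbedding ⟨ψ.contMDiff, hiso⟩ hτ O 4 d R₀ hc hf hesc hv
  refine ⟨(ψ : 𝒟₁.carrier → 𝒟₂.carrier) '' O, d', R₀, ?_, hc', hf', hv'⟩
  rw [hch, ← image_exteriorOf ψ hiso hτ hι, ← hO]

/-- **The universal conjunct of `P_T` (`settledT`) is transported along isometries of developments**:
as `rayless_of_isIsometricTo`, plus the rays clause `RaysStayInClosure 𝒟₁ O → RaysStayInClosure 𝒟₂ ψ(O)`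
(private copy of `ClusterCompleteness.raysStayInClosure_image_of_isometry`: rays lift along isometries on
the same affine domain). [cite: ChoquetBruhatGeroch1969CMP, Thm. 3] -/
theorem settledT_of_isIsometricTo {𝒟₁ 𝒟₂ : VacuumCauchyDevelopment D}
    (h : 𝒟₁.toCauchyDevelopment.IsIsometricTo 𝒟₂.toCauchyDevelopment) (hS : 𝒟₁ ∈ settledT D) :
    𝒟₂ ∈ settledT D := by
  obtain ⟨hI, O, d, R₀, hO, hrays, hc, hf, hv⟩ := hS
  refine ⟨(hasCompleteNullInfinity_iff_of_isIsometricTo _ _ h).1 hI, ?_⟩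
  obtain ⟨ψ, hiso, hτ, hι⟩ := h
  have hesc : ∀ τ' : ℝ, d.τ₀ < τ' →
      closure ((ψ : 𝒟₁.carrier → 𝒟₂.carrier) '' (d.flatChart '' {y | τ' ≤ y.1 0 ∧
        ∀ i, d.excision i (y.1 0) + 1 ≤ (d.background i).radius y.1})) ⊆
          Set.range (ψ : 𝒟₁.carrier → 𝒟₂.carrier) := fun τ' _ z _ ↦
    ⟨ψ.symm z, ψ.apply_symm_apply z⟩
  obtain ⟨d', hch, hc', hf', hv'⟩ :=
    exists_honestPushforward_velocity 𝒟₁.toSpacetime 𝒟₂.toSpacetime ψ ψ.contMDiff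
      ψ.toHomeomorph.isOpenEmbedding ⟨ψ.contMDiff, hiso⟩ hτ O 4 d R₀ hc hf hesc hv
  refine ⟨(ψ : 𝒟₁.carrier → 𝒟₂.carrier) '' O, d', R₀, ?_,
    raysStayInClosure_image_of_isometry' ψ hiso hτ hι O hrays, hc', hf', hv'⟩
  rw [hch, ← image_exteriorOf ψ hiso hτ hι, ← hO]

/-- `settledT` is constant on isometry classes of developments. [folklore] -/
theorem mem_settledT_iff_of_isIsometricTo {𝒟₁ 𝒟₂ : VacuumCauchyDevelopment D}
    (h : 𝒟₁.toCauchyDevelopment.IsIsometricTo 𝒟₂.toCauchyDevelopment) :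
    𝒟₁ ∈ settledT D ↔ 𝒟₂ ∈ settledT D :=
  ⟨settledT_of_isIsometricTo h, settledT_of_isIsometricTo h.symm⟩

variable (D) in
/-- **`P_T` per datum collapses to one development**: "an MGHD exists and every MGHD is `T`-settled" iff
"SOME maximal development is `T`-settled" (MGHD uniqueness up to isometry,
`VacuumCauchyDevelopment.isIsometricTo_of_isMaximal'`, + `settledT_of_isIsometricTo`).
[cite: ChoquetBruhatGeroch1969CMP, Thm. 3] -/
theorem PT_iff_exists_isMaximal_settledT :
    ((∃ 𝒟 : VacuumCauchyDevelopment D, 𝒟.IsMaximal) ∧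
        ∀ 𝒟 : VacuumCauchyDevelopment D, 𝒟.IsMaximal → 𝒟 ∈ settledT D) ↔
      ∃ 𝒟 : VacuumCauchyDevelopment D, 𝒟.IsMaximal ∧ 𝒟 ∈ settledT D := by
  constructor
  · rintro ⟨⟨𝒟₀, h𝒟₀⟩, hall⟩
    exact ⟨𝒟₀, h𝒟₀, hall 𝒟₀ h𝒟₀⟩
  · rintro ⟨𝒟₀, h𝒟₀, hS⟩
    exact ⟨⟨𝒟₀, h𝒟₀⟩, fun 𝒟 h𝒟 ↦
      settledT_of_isIsometricTo (VacuumCauchyDevelopment.isIsometricTo_of_isMaximal' h𝒟₀ h𝒟) hS⟩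

variable (D) in
/-- Rays-less analogue of `PT_iff_exists_isMaximal_settledT` (the member property of the dynamical stub of
line `Sketch` collapses to its `∃`-form). [cite: ChoquetBruhatGeroch1969CMP, Thm. 3] -/
theorem PTnr_iff_exists_isMaximal :
    ((∃ 𝒟 : VacuumCauchyDevelopment D, 𝒟.IsMaximal) ∧
        ∀ 𝒟 : VacuumCauchyDevelopment D, 𝒟.IsMaximal →
          HasCompleteNullInfinity 𝒟.toCauchyDevelopment ∧
            ∃ (O : Set 𝒟.carrier) (d : FinalStateDecomposition 𝒟.toSpacetime O 4) (R₀ : ℝ),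
              O = exteriorOf 𝒟.toCauchyDevelopment d.charted ∧
                d ∈ honestCoreSet 𝒟.toSpacetime O 4 R₀ ∧ d ∈ honestFarSet 𝒟.toSpacetime O 4 R₀ ∧
                  d ∈ velocitySet 𝒟.toSpacetime O 4) ↔
      ∃ 𝒟 : VacuumCauchyDevelopment D, 𝒟.IsMaximal ∧
        (HasCompleteNullInfinity 𝒟.toCauchyDevelopment ∧
          ∃ (O : Set 𝒟.carrier) (d : FinalStateDecomposition 𝒟.toSpacetime O 4) (R₀ : ℝ),
            O = exteriorOf 𝒟.toCauchyDevelopment d.charted ∧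
              d ∈ honestCoreSet 𝒟.toSpacetime O 4 R₀ ∧ d ∈ honestFarSet 𝒟.toSpacetime O 4 R₀ ∧
                d ∈ velocitySet 𝒟.toSpacetime O 4) := by
  constructor
  · rintro ⟨⟨𝒟₀, h𝒟₀⟩, hall⟩
    exact ⟨𝒟₀, h𝒟₀, hall 𝒟₀ h𝒟₀⟩
  · rintro ⟨𝒟₀, h𝒟₀, hS⟩
    exact ⟨⟨𝒟₀, h𝒟₀⟩, fun 𝒟 h𝒟 ↦
      rayless_of_isIsometricTo (VacuumCauchyDevelopment.isIsometricTo_of_isMaximal' h𝒟₀ h𝒟) hS⟩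

end PerDevelopment

/-! ### §3 The single-development collapse of the crux -/

section Genericity

variable {X : Type} [TopologicalSpace X] [ChartedSpace E3 X] [IsManifold (𝓡 3) ∞ X]

/-- Tame genericity is monotone under pointwise implication on the class (local copy). [folklore] -/
private theorem isTameChristodoulouGeneric_mono₄ {𝓓 : Set (InitialDataSet (𝓡 3) X)}
    {P Q : InitialDataSet (𝓡 3) X → Prop} {m : ℕ}
    (h : InitialDataSet.IsTameChristodoulouGeneric 𝓓 P m) (hPQ : ∀ d ∈ 𝓓, P d → Q d) :
    InitialDataSet.IsTameChristodoulouGeneric 𝓓 Q m := by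
  intro d hd
  obtain ⟨e, F, hF, himm, h0, hinj, hadm, hexc⟩ := h d ⟨hd.1, fun hP ↦ hd.2 (hPQ d hd.1 hP)⟩
  exact ⟨e, F, hF, himm, h0, hinj, hadm,
    fun c hc hmem ↦ hexc c hc ⟨hmem.1, fun hP ↦ hmem.2 (hPQ _ hmem.1 hP)⟩⟩

/-- Tame genericity of pointwise-equivalent properties agrees. [folklore] -/
private theorem isTameChristodoulouGeneric_congr {𝓓 : Set (InitialDataSet (𝓡 3) X)}
    {P Q : InitialDataSet (𝓡 3) X → Prop} {m : ℕ} (hPQ : ∀ d ∈ 𝓓, P d ↔ Q d) :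
    InitialDataSet.IsTameChristodoulouGeneric 𝓓 P m ↔ InitialDataSet.IsTameChristodoulouGeneric 𝓓 Q m :=
  ⟨fun h ↦ isTameChristodoulouGeneric_mono₄ h fun d hd ↦ (hPQ d hd).1,
    fun h ↦ isTameChristodoulouGeneric_mono₄ h fun d hd ↦ (hPQ d hd).2⟩

end Genericity

/-- **THE CRUX IS ITS SINGLE-DEVELOPMENT FORM.** `HonestFixedRadiusSettlingT` — for every `Σ`,
tame-generically "an MGHD exists and every MGHD is `T`-settled" (`FlatClass.T_iff`, `Iff.rfl`) — is
equivalent to "for every `Σ`, tame-generically, SOME maximal vacuum Cauchy development is `T`-settled",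
by MGHD uniqueness up to isometry of developments and transport of the universal conjunct
(`PT_iff_exists_isMaximal_settledT`). This is the `∃`-form a dynamical (stability) theorem produces: one
development per datum, no `∀ MGHD`. [cite: ChoquetBruhatGeroch1969CMP, Thm. 3] -/
theorem T_iff_tame_generic_exists_settledT :
    HonestFixedRadiusSettlingT ↔
      ∀ (X : Type) [TopologicalSpace X] [ChartedSpace E3 X] [IsManifold (𝓡 3) ∞ X] [T2Space X]
        [SecondCountableTopology X] [ConnectedSpace X],
        InitialDataSet.IsTameChristodoulouGeneric (admissibleVacuumData X)
          (fun D ↦ ∃ 𝒟 : VacuumCauchyDevelopment D, 𝒟.IsMaximal ∧ 𝒟 ∈ settledT D) 1 := by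
  rw [HonestFixedRadiusSettlingT.Negative.FlatClass.T_iff]
  exact ⟨fun h X _ _ _ _ _ _ ↦ (isTameChristodoulouGeneric_congr fun D _ ↦
      PT_iff_exists_isMaximal_settledT D).1 (h X),
    fun h X _ _ _ _ _ _ ↦ (isTameChristodoulouGeneric_congr fun D _ ↦
      PT_iff_exists_isMaximal_settledT D).2 (h X)⟩

/-- **The rays-less core is its single-development form** (the same collapse for the dynamical content
isolated by line `Sketch`, `CoreReduction.T_iff_rayless`): for every `Σ`, tame-generically "an MGHD exists
and every MGHD satisfies the rays-less conjunct" iff tame-generically "SOME maximal development satisfies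
it". [cite: ChoquetBruhatGeroch1969CMP, Thm. 3] -/
theorem rayless_iff_tame_generic_exists (X : Type) [TopologicalSpace X] [ChartedSpace E3 X]
    [IsManifold (𝓡 3) ∞ X] [T2Space X] [SecondCountableTopology X] [ConnectedSpace X] :
    InitialDataSet.IsTameChristodoulouGeneric (admissibleVacuumData X)
        (fun D ↦ (∃ 𝒟 : VacuumCauchyDevelopment D, 𝒟.IsMaximal) ∧
          ∀ 𝒟 : VacuumCauchyDevelopment D, 𝒟.IsMaximal →
            HasCompleteNullInfinity 𝒟.toCauchyDevelopment ∧
              ∃ (O : Set 𝒟.carrier) (d : FinalStateDecomposition 𝒟.toSpacetime O 4) (R₀ : ℝ),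
                O = exteriorOf 𝒟.toCauchyDevelopment d.charted ∧
                  d ∈ honestCoreSet 𝒟.toSpacetime O 4 R₀ ∧ d ∈ honestFarSet 𝒟.toSpacetime O 4 R₀ ∧
                    d ∈ velocitySet 𝒟.toSpacetime O 4) 1 ↔
      InitialDataSet.IsTameChristodoulouGeneric (admissibleVacuumData X)
        (fun D ↦ ∃ 𝒟 : VacuumCauchyDevelopment D, 𝒟.IsMaximal ∧
          (HasCompleteNullInfinity 𝒟.toCauchyDevelopment ∧
            ∃ (O : Set 𝒟.carrier) (d : FinalStateDecomposition 𝒟.toSpacetime O 4) (R₀ : ℝ),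
              O = exteriorOf 𝒟.toCauchyDevelopment d.charted ∧
                d ∈ honestCoreSet 𝒟.toSpacetime O 4 R₀ ∧ d ∈ honestFarSet 𝒟.toSpacetime O 4 R₀ ∧
                  d ∈ velocitySet 𝒟.toSpacetime O 4)) 1 :=
  isTameChristodoulouGeneric_congr fun D _ ↦ PTnr_iff_exists_isMaximal D

end Summit.FinalStateConjecture.FinalStateConjecture.Theorems.StarvedNecks.SingleDevelopment

end
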